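import Summits.QuantumFields.YangMills.Theorems.UnitScaleTiltProp7DefBookingEM
import Summits.QuantumFields.YangMills.Theorems.UnitScaleTiltProp7CovConstraintSplitOfRegPr
import Summits.QuantumFields.YangMills.Theorems.UnitScaleTiltProp7CovFaceFluxRow
import Summits.QuantumFields.YangMills.Theorems.UnitScaleTiltProp7CovFaceFluxLineStep
import Summits.QuantumFields.YangMills.Theorems.UnitScaleTiltProp7CoclosedEnergiesOfHKgK
import Summits.QuantumFields.YangMills.Theorems.UnitScaleTiltProp7CovCombMeanFrames
import HarnessLib

/-!
# Route `UnitScaleTilt`, crux K1 «MinimiserStabilityRegPr» (stmt-QuantumFields-19200), route-R E′ S3 K-form engine, R5 door ✓`Prop7ZetaRowOfEngineRows` — ROW (P) KNIT: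
# THE COVARIANT FACE-FLUX ∕ POINCARÉ ROW (P′) `δ^V(φ₀) ≤ ℓ(ζ_P∕θ′)K + θ′ℓ⁻¹M + θ_P·e·ℓ⁻¹M + C_P·ℓ·G_W(B) + C_Λ·ℓ·CURL_HS(B) + η·ℓ·DIV(D)` AT THE MEMBER, FROM TWO DISPLAYED ROWS —
# the Gauss composite `hXb` and the fibre-defect row `hq` — everything else by kernel (R2′ ✓p666871, the reduced-vs-engine defect ✓p679745, the line-vs-face step ✓p669695, px17's R3′ door ✓p669468)

Cell `ym3-torus`, width seat `ym3-torus-px5` (gen 3); ★ym-ust-19200-p1 g16 NAMER WORD 5 (spec) ∕ WORD 6 (ii)(iii) ∕ WORD 8 (2) «ROW (P) KNIT — open call», «MINE» 2026-08-28 23:50Z;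
LOCATE-ROWP-KNIT-px5g3.md (19200 evidence #51).  THEOREMS ONLY (0 `def`, 0 `sorry`); `--supports stmt-QuantumFields-19200 --as helper`, count-neutral.  YM₃ on T³ is a ladder rung (R3),
not the Clay problem; nothing here claims the stub, the crux, d = 4 or the mass gap; the two analytic rows `hXb`, `hq` are DISPLAYED, not proved.

THE CHAIN (DESIGN-S3-KFORM-ENGINE-g15 R2′∕R3′; the R5 door's docstring for (P)).  Member of a T³ family, background `W` with the plaquette clause `dist1(W(∂p)) ≤ e·ℓ⁻²` (`ℓ = L^{K−n}`,
`0 < e`, `10⁶L⁵e ≤ 1`), a co-closed covariant Hodge split `D = B + D_Wφ₀` of the chart, the true linearised iterate `Q` of record (displayed by its recursion):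
(1) the reduced ∕ pure-LINE ∕ coarse-gauge families `G S Λ` OF `B` exist (✓`exists_reduced_family`, ✓`exists_pureLine_family`, ✓`exists_coarseGauge_family`; inside, not displayed);
(2) R2′ ✓`Prop7CovConstraintSplitOfRegPr.covConstraintSplit_coclosed_T3`: the EXACT identity `G_{K−n}(c) + P_{W̄}(Λ − φ₀∘embIter)(c) = Q^{(K−n)}D(c)` (= the R3′ door's `hR2`) and the
    `(H¹)*`-bound `Σ_y‖Λ y‖² ≤ ℓ(200L⁴·CURL_HS(B) + 4·10⁹L⁹·e·ℓ⁻²·Σ‖B‖²)`;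
(3) the door's `hL`: ✓`Prop7DefBookingEM.sum_normSq_reduced_sub_engine_le_of_tower` (this seat, ✓p679745) at `ε := 2e` — `8·Σ_c‖G_{K−n}(c) − X_c‖² ≤ 64(C_G + C_S²)·e·ℓ⁻¹·M` (its d = 3 reading `def_booking_eM_d3`), `X` the
    engine's covariant straight-line block functional in the centre frame (numerals by ✓`Prop7CurvedLandauKnitT3.smallness_T3`);
(4) the door's `hE`: px17's ✓`Prop7CovFaceFluxLineStep.sum_normSq_lineFun_sub_faceFun_le` at the member letters (units field `W♭`, centre frames, comb prefixes, the FAR-FACE crossing index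
    `t₀(c, r) = ℓ − 1 − r_{μ_c}`) — `Σ_c‖X_c − FACE_c‖² ≤ ℓ⁴ℓ⁻³·G_long(B) ≤ ℓ·G_W(B)`;
(5) DISPLAYED `hXb` (the Gauss composite in (P) currencies; px17's inhabitant chain BLOCK-GAUSS ✓p669014 + ✓p670095 + Σ₁ + J_VH) and `hq` (the fibre-defect row, pure mass `θ_q·ℓ⁻¹·M`);
(6) px17's R3′ door ✓`Prop7CovFaceFluxRow.sum_normSq_centreDiff_le_of_rows` (`N = 2`, `d = 3`); (7) bookkeeping with `Σ‖B‖² ≤ 2M` (px12 ✓`sum_norm_sq_le_of_coclosed_split`) and `e ≤ 1`.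
OUTPUT: `δ^V ≤ ℓ(ζ_X∕θ)K + (θ + θ_q)ℓ⁻¹M + (θ_X + 64(C_G+C_S²) + 7.68·10¹¹L⁹)·e·ℓ⁻¹M + (C_X + 8)·ℓ·G_W(B) + 19200L⁴·ℓ·CURL_HS(B) + (η_X + η_q)·ℓ·DIV(D)` — ROW (P′) of the R5 door v2
✓`Prop7ZetaRowOfEngineRowsAbs` (★p1 g16 2026-08-29 00:01Z: (P) + the absorbed divergence slot `η·ℓ·DIV(D)`; both displayed rows carry their own slot `η_X`, `η_q`) at `θ′ := θ + θ_q`, `ζ_P := ζ_X(θ + θ_q)∕θ`,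
`θ_P := θ_X + 64(C_G+C_S²) + 7.68·10¹¹L⁹`, `C_P := C_X + 8`, `C_Λ := 19200L⁴`, `η := η_X + η_q` (`C_G = (4770L³)²(25L²∕2)²∕4`, `C_S = 250L²∕((L−1)(L²−1)) + (10L+7)²∕2`; at `η_X = η_q = 0` it is row (P) of ✓p677112).

WHAT IS PROVED (ns `…Theorems.Prop7RowPOfFaceFluxRows`): §1 letters — `real_smul_eq_coe_smul` (the ℝ∕ℂ-scalar seam between ✓p669695's `LINE` and ✓RowE's `X`), `holT_unitsField_mem_U1`,
`sum_longGrad_le_covGrad` (`G_long(B) ≤ G_W(B)`: the `ν = μ_b` summand); §2 ★★★ `rowP_of_faceFluxRows` — the knit.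
HONEST SCOPE.  Composition of landed theorems; `hXb` and `hq` are INPUTS (their inhabitants are px17's Gauss chain and routeR-w2's pointwise second-order defect row); constants crude,
`L`-only; no estimate of Bałaban's is asserted.

References: T. Bałaban, CMP 102 (1985) 277–309 [Balaban1985Variational] ((6) p.278, (135) p.298, (141)–(143) p.299, Prop. 7 p.299); CMP 99 (1985) 389–434 [Balaban1985BackgroundPropagators]
((3.3)–(3.4) pp.390–391, (3.8)–(3.10) p.392, (3.117)–(3.122) pp.419–420, Thm 3.11 p.416); CMP 95 (1984) 17–40 [Balaban1984PropagatorsI] ((1.18)–(1.21) pp.19–21, Prop. 1.1 (1.90) p.33);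
CMP 98 (1985) 17–51 [Balaban1985Averaging] ((11) p.19, Prop. 2 (53) p.26, Prop. 3 (124)–(126) p.36).
-/

set_option autoImplicit false

noncomputable section

open scoped BigOperators Matrix.Norms.L2Operator Matrix

namespace Summit.QuantumFields.YangMills.Theorems.Prop7RowPOfFaceFluxRows

open Literature.MathematicalPhysics.QuantumFieldTheory.Balaban1983to89
open Literature.MathematicalPhysics.QuantumFieldTheory.Balaban1983to89.T3ContinuumYM3Torus
open Finset T4Continuum T4ReflectionCone BlockAveraging AveragingRT ExpMeanLog BlockAveragingEMLLinearised BlockAveragingEMLLinearisedBackground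
  BlockAveragingEMLProp2 B1RG242Torus
open B15DeterminingSets (embIter)
open B7Prop1Explicit (U1 treeWord)
open B7Eq78Linearization (conjR)
open B9Eq39Adjoint (covD divB curl)
open B9TorusCalculus (torusT)
open B10Eq27TorusAxialLog (holT unitsField toUField holT_nil holT_cons_true holT_cons_false)
open Summit.QuantumFields.YangMills.Theorems.Prop7CovIterLambdaBound (plaqSmall_of_le_of_lt)
open Summit.QuantumFields.YangMills.Theorems.Prop7CurvedLandauKnitT3 (smallness_T3 three_le_L)
open Summit.QuantumFields.YangMills.Theorems.Prop7CurvedLandauRowA (exists_reduced_family exists_coarseGauge_family)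
open Summit.QuantumFields.YangMills.Theorems.Prop7LineIterVsEngineOfTower (exists_pureLine_family)
open Summit.QuantumFields.YangMills.Theorems.Prop7CovConstraintSplitOfRegPr (covConstraintSplit_coclosed_T3)
open Summit.QuantumFields.YangMills.Theorems.Prop7DefBookingEM (sum_normSq_reduced_sub_engine_le_of_tower)
open Summit.QuantumFields.YangMills.Theorems.Prop7CovFaceFluxLineStep (sum_normSq_lineFun_sub_faceFun_le)
open Summit.QuantumFields.YangMills.Theorems.Prop7CovFaceFluxRow (sum_normSq_centreDiff_le_of_rows)
open Summit.QuantumFields.YangMills.Theorems.Prop7CoclosedEnergiesOfHKgK (sum_norm_sq_le_of_coclosed_split)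
open Summit.QuantumFields.YangMills.Theorems.Prop7CovCombMeanFrames (conjR_bond_su)

/-! ## §1 Letters -/

/-- The ℝ∕ℂ-scalar seam: a real scalar acting on a complex matrix is the coerced complex scalar. [folklore] -/
theorem real_smul_eq_coe_smul {N : ℕ} (r : ℝ) (A : Matrix (Fin N) (Fin N) ℂ) : r • A = (r : ℂ) • A := by
  ext i j
  simp [Matrix.smul_apply, Complex.real_smul]

/-- Transports of the units reading `W♭` of an `SU(2)` field lie in `U1` (`U1` is a subgroup and every bond variable lies in it).
[cite: Balaban1985Averaging, (19) p.21] -/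
theorem holT_unitsField_mem_U1 {P : Params} {j : ℕ} (W : GaugeField P j (Matrix.specialUnitaryGroup (Fin 2) ℂ)) :
    ∀ (x : Site P j) (w : List (B7Prop1Explicit.Letter P.d)), holT (unitsField (toUField W)) x w ∈ U1 (Matrix (Fin 2) (Fin 2) ℂ)
  | x, [] => by rw [holT_nil]; exact (U1 _).one_mem
  | x, (μ, true) :: w => by
      rw [holT_cons_true]
      exact (U1 _).mul_mem (B11Thm1LevelZero.unitsField_toUField_mem_U1 W _) (holT_unitsField_mem_U1 W _ _)
  | x, (μ, false) :: w => by
      rw [holT_cons_false]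
      exact (U1 _).mul_mem ((U1 _).inv_mem (B11Thm1LevelZero.unitsField_toUField_mem_U1 W _)) (holT_unitsField_mem_U1 W _ _)

/-- `G_long(B) ≤ G_W(B)`: the longitudinal covariant gradient energy (the (E)-row's letter, ✓`sum_normSq_lineFun_sub_faceFun_le`) is the `ν = μ_b` summand of the all-direction covariant
gradient energy of the R5 door. [cite: Balaban1985BackgroundPropagators, (3.3) p.390] -/
theorem sum_longGrad_le_covGrad {P : Params} {N : ℕ} (W : GaugeField P 0 (Matrix.specialUnitaryGroup (Fin N) ℂ)) (B : PBond P 0 → Matrix (Fin N) (Fin N) ℂ) :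
    ∑ b : PBond P 0, ‖conjR (unitsField (toUField W) b) (B ⟨b.src.shift b.dir, b.dir⟩) - B b‖ ^ 2
      ≤ ∑ b : PBond P 0, ∑ ν : Fin P.d,
          ‖((W ⟨b.src, ν⟩ : Matrix.specialUnitaryGroup (Fin N) ℂ) : Matrix (Fin N) (Fin N) ℂ) * B ⟨b.src.shift ν, b.dir⟩
              * star ((W ⟨b.src, ν⟩ : Matrix.specialUnitaryGroup (Fin N) ℂ) : Matrix (Fin N) (Fin N) ℂ) - B b‖ ^ 2 := by
  refine Finset.sum_le_sum fun b _ => ?_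
  have h := Finset.single_le_sum (s := (Finset.univ : Finset (Fin P.d)))
    (f := fun ν => ‖((W ⟨b.src, ν⟩ : Matrix.specialUnitaryGroup (Fin N) ℂ) : Matrix (Fin N) (Fin N) ℂ) * B ⟨b.src.shift ν, b.dir⟩
              * star ((W ⟨b.src, ν⟩ : Matrix.specialUnitaryGroup (Fin N) ℂ) : Matrix (Fin N) (Fin N) ℂ) - B b‖ ^ 2)
    (fun _ _ => sq_nonneg _) (Finset.mem_univ b.dir)
  refine le_trans (le_of_eq ?_) h
  rw [conjR_bond_su]

/-! ## §2 ★★★ ROW (P) of the R5 door from the two displayed rows -/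

set_option maxHeartbeats 400000 in
/-- ★★★ **ROW (P) KNIT.**  Member of a T³ family (`N = 2`, `d = 3`), level `K − n`, `ℓ = L^{K−n}`; background `W` with `dist1(W(∂p)) ≤ e·ℓ⁻²`, `0 < e`, `10⁶L⁵e ≤ 1`; a co-closed covariant
Hodge split `D = B + D_Wφ₀`; the true linearised iterate `Q` displayed by its recursion.  DISPLAYED ROWS: `hXb` — the Gauss composite
`2|Σ_c Re tr((φ₀(c₋) − W̄(c)φ₀(c₊)W̄(c)*)ᴴ·FACE_c)| ≤ ℓ(ζ_X∕θ)K + θℓ⁻¹M + θ_X·e·ℓ⁻¹M + C_X·ℓ·G_W(B) + η_X·ℓ·DIV(D)` (FACE = the per-line face functional of `B` at the far-face crossing, centre frame) —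
and `hq` — `8·Σ_c‖Q^{(K−n)}D(c)‖² ≤ θ_q·ℓ⁻¹·M`.  CONCLUSION = row (P) of ✓`Prop7ZetaRowOfEngineRows.zetaRow_of_engineRows` at
`(ζ_P∕θ′, θ′, θ_P, C_P, C_Λ) := (ζ_X∕θ, θ + θ_q, θ_X + 64(C_G+C_S²) + 768·10⁹L⁹, C_X + 8, 19200L⁴)`.
[cite: Balaban1985Variational, (6) p.278, (141)-(143) p.299, Prop. 7 p.299; Balaban1985BackgroundPropagators, (3.8)-(3.10) p.392, (3.117)-(3.122) pp.419-420, Thm 3.11 p.416; Balaban1984PropagatorsI, (1.18)-(1.21) pp.19-21, Prop. 1.1 (1.90) p.33; Balaban1985Averaging, (11) p.19, Prop. 2 (53) p.26] -/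
theorem rowP_of_faceFluxRows (F : T3Family) (n K : ℕ) (W : GaugeField (F.P K) 0 (Matrix.specialUnitaryGroup (Fin 2) ℂ))
    {e θ ζ_X θ_X C_X η_X θ_q η_q : ℝ} (he : 0 < e) (heL : 1000000 * (F.L : ℝ) ^ 5 * e ≤ 1)
    (hW : ∀ p : Plaq (F.P K) 0, dist1 (GaugeField.plaqHol W p) ≤ e * (((F.L : ℝ) ^ (K - n)) ^ 2)⁻¹)
    (D B : PBond (F.P K) 0 → Matrix (Fin 2) (Fin 2) ℂ) (φ₀ : Site (F.P K) 0 → Matrix (Fin 2) (Fin 2) ℂ)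
    (hsplit : ∀ b : PBond (F.P K) 0, D b = B b + covD (torusT (F.P K) 0) (fun κ z => unitsField (toUField W) ⟨z, κ⟩) b.dir φ₀ b.src)
    (hBc : ∀ x : Site (F.P K) 0, divB (torusT (F.P K) 0) (fun κ z => unitsField (toUField W) ⟨z, κ⟩) (fun κ z => B ⟨z, κ⟩) x = 0)
    -- the true linearised iterate of record, displayed by its recursion (✓`exists_trueLinIter_family`)
    (Q : (k : ℕ) → (PBond (F.P K) 0 → Matrix (Fin 2) (Fin 2) ℂ) → PBond (F.P K) k → Matrix (Fin 2) (Fin 2) ℂ) (hQ0 : ∀ Y, Q 0 Y = Y)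
    (hQs : ∀ (k : ℕ) (Y : PBond (F.P K) 0 → Matrix (Fin 2) (Fin 2) ℂ) (c : PBond (F.P K) (k + 1)), Q (k + 1) Y c
      = fderiv ℂ (eml : (Idx (F.P K) → Matrix (Fin 2) (Fin 2) ℂ) → Matrix (Fin 2) (Fin 2) ℂ)
            (fun i => ((loopHol (Averaging.iter (fun i => blockAvg (P := F.P K) (j := i) (expMeanLogSU (n := Fin 2))) k W) c i :
              Matrix.specialUnitaryGroup (Fin 2) ℂ) : Matrix (Fin 2) (Fin 2) ℂ))
            (fun i => covWalkSum (Averaging.iter (fun i => blockAvg (P := F.P K) (j := i) (expMeanLogSU (n := Fin 2))) k W) (Q k Y)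
                (walk (emb c.src) (loopWord (F.P K).L c.dir (off i.1) i.2.1 i.2.2))
              * ((loopHol (Averaging.iter (fun i => blockAvg (P := F.P K) (j := i) (expMeanLogSU (n := Fin 2))) k W) c i :
                Matrix.specialUnitaryGroup (Fin 2) ℂ) : Matrix (Fin 2) (Fin 2) ℂ))
            * star ((corr (expMeanLogSU (n := Fin 2)) (Averaging.iter (fun i => blockAvg (P := F.P K) (j := i) (expMeanLogSU (n := Fin 2))) k W) c :
                Matrix.specialUnitaryGroup (Fin 2) ℂ) : Matrix (Fin 2) (Fin 2) ℂ)
          + ((corr (expMeanLogSU (n := Fin 2)) (Averaging.iter (fun i => blockAvg (P := F.P K) (j := i) (expMeanLogSU (n := Fin 2))) k W) c :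
                Matrix.specialUnitaryGroup (Fin 2) ℂ) : Matrix (Fin 2) (Fin 2) ℂ)
            * covWalkSum (Averaging.iter (fun i => blockAvg (P := F.P K) (j := i) (expMeanLogSU (n := Fin 2))) k W) (Q k Y)
                (walk (emb c.src) (List.replicate (F.P K).L (c.dir, true)))
            * star ((corr (expMeanLogSU (n := Fin 2)) (Averaging.iter (fun i => blockAvg (P := F.P K) (j := i) (expMeanLogSU (n := Fin 2))) k W) c :
                Matrix.specialUnitaryGroup (Fin 2) ℂ) : Matrix (Fin 2) (Fin 2) ℂ))
    -- ▢ hq — THE FIBRE-DEFECT ROW (pointwise second order along the averaging paths; routeR-w2): `8·Σ_c‖Q^{(K−n)}D(c)‖² ≤ θ_q·ℓ⁻¹·M + η_q·ℓ·DIV(D)`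
    (hq : 8 * ∑ c : PBond (F.P K) (K - n), ‖Q (K - n) D c‖ ^ 2 ≤ θ_q * ((F.L : ℝ) ^ (K - n))⁻¹ * (∑ b : PBond (F.P K) 0, ‖D b‖ ^ 2)
        + η_q * ((F.L : ℝ) ^ (K - n)) * (∑ x : Site (F.P K) 0, ∑ j : Fin 2, ∑ k : Fin 2,
              ‖(divB (torusT (F.P K) 0) (fun κ z => unitsField (toUField W) ⟨z, κ⟩) (fun κ z => Complex.I • D ⟨z, κ⟩) x) j k‖ ^ 2))
    -- ▢ hXb — THE GAUSS COMPOSITE (px17: BLOCK-GAUSS + FACE∕FACE′ + Σ₁ + J_VH), FACE = per-line face functional of `B` at the far-face crossing, centre frame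
    (hXb : 2 * |∑ c : PBond (F.P K) (K - n), (((φ₀ (embIter (K - n) c.src)
          - ((Averaging.iter (fun i => blockAvg (P := F.P K) (j := i) (expMeanLogSU (n := Fin 2))) (K - n) W c : Matrix.specialUnitaryGroup (Fin 2) ℂ) : Matrix (Fin 2) (Fin 2) ℂ)
              * φ₀ (embIter (K - n) c.tgt)
              * star ((Averaging.iter (fun i => blockAvg (P := F.P K) (j := i) (expMeanLogSU (n := Fin 2))) (K - n) W c : Matrix.specialUnitaryGroup (Fin 2) ℂ) : Matrix (Fin 2) (Fin 2) ℂ))ᴴ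
          * ((((((F.P K).L : ℝ) ^ (K - n)) ^ (F.P K).d)⁻¹ •
              (((holAt W (walk (embIter (K - n) c.src) (treeWord fun _ : Fin (F.P K).d => -((((F.P K).L ^ (K - n) - 1) / 2 : ℕ) : ℤ))) : Matrix.specialUnitaryGroup (Fin 2) ℂ) :
                  Matrix (Fin 2) (Fin 2) ℂ)
                * ((((F.P K).L : ℝ) ^ (K - n)) • ∑ r : Fin (F.P K).d → Fin ((F.P K).L ^ (K - n)),
                    conjR (holT (unitsField (toUField W)) (Site.fibreSite 0 (K - n) c.src fun _ => ⟨0, pow_pos (F.P K).L_pos (K - n)⟩) (treeWord fun ν => ((r ν : ℕ) : ℤ))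
                        * holT (unitsField (toUField W)) (Site.fibreSite 0 (K - n) c.src r) (List.replicate ((F.P K).L ^ (K - n) - 1 - (r c.dir : ℕ)) (c.dir, true)))
                      (B ⟨(fun z : Site (F.P K) 0 => z.shift c.dir)^[(F.P K).L ^ (K - n) - 1 - (r c.dir : ℕ)] (Site.fibreSite 0 (K - n) c.src r), c.dir⟩))
                * star (((holAt W (walk (embIter (K - n) c.src) (treeWord fun _ : Fin (F.P K).d => -((((F.P K).L ^ (K - n) - 1) / 2 : ℕ) : ℤ))) : Matrix.specialUnitaryGroup (Fin 2) ℂ) :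
                  Matrix (Fin 2) (Fin 2) ℂ)))))).trace).re|
      ≤ ((F.L : ℝ) ^ (K - n)) * (ζ_X / θ) * (∑ p : Plaq (F.P K) 0, ‖((Complex.I • D ⟨p.src, p.μ⟩) + ((W ⟨p.src, p.μ⟩ : Matrix (Fin 2) (Fin 2) ℂ) * (Complex.I • D ⟨p.src.shift p.μ, p.ν⟩) * star (W ⟨p.src, p.μ⟩ : Matrix (Fin 2) (Fin 2) ℂ))
            - (((W ⟨p.src, p.μ⟩ * W ⟨p.src.shift p.μ, p.ν⟩ * (W ⟨p.src.shift p.ν, p.μ⟩)⁻¹ : Matrix.specialUnitaryGroup (Fin 2) ℂ) : Matrix (Fin 2) (Fin 2) ℂ) * (Complex.I • D ⟨p.src.shift p.ν, p.μ⟩) * star ((W ⟨p.src, p.μ⟩ * W ⟨p.src.shift p.μ, p.ν⟩ * (W ⟨p.src.shift p.ν, p.μ⟩)⁻¹ : Matrix.specialUnitaryGroup (Fin 2) ℂ) : Matrix (Fin 2) (Fin 2) ℂ))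
            - (((GaugeField.plaqHol W p : Matrix.specialUnitaryGroup (Fin 2) ℂ) : Matrix (Fin 2) (Fin 2) ℂ) * (Complex.I • D ⟨p.src, p.ν⟩) * star ((GaugeField.plaqHol W p : Matrix.specialUnitaryGroup (Fin 2) ℂ) : Matrix (Fin 2) (Fin 2) ℂ)))‖ ^ 2)
        + θ * ((F.L : ℝ) ^ (K - n))⁻¹ * (∑ b : PBond (F.P K) 0, ‖D b‖ ^ 2)
        + θ_X * e * ((F.L : ℝ) ^ (K - n))⁻¹ * (∑ b : PBond (F.P K) 0, ‖D b‖ ^ 2)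
        + C_X * ((F.L : ℝ) ^ (K - n)) * (∑ b : PBond (F.P K) 0, ∑ ν : Fin (F.P K).d,
                ‖((W ⟨b.src, ν⟩ : Matrix.specialUnitaryGroup (Fin 2) ℂ) : Matrix (Fin 2) (Fin 2) ℂ) * B ⟨b.src.shift ν, b.dir⟩ * star ((W ⟨b.src, ν⟩ : Matrix.specialUnitaryGroup (Fin 2) ℂ) : Matrix (Fin 2) (Fin 2) ℂ) - B b‖ ^ 2)
        + η_X * ((F.L : ℝ) ^ (K - n)) * (∑ x : Site (F.P K) 0, ∑ j : Fin 2, ∑ k : Fin 2,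
              ‖(divB (torusT (F.P K) 0) (fun κ z => unitsField (toUField W) ⟨z, κ⟩) (fun κ z => Complex.I • D ⟨z, κ⟩) x) j k‖ ^ 2)) :
    (∑ c : PBond (F.P K) (K - n), ∑ a : Fin 2, ∑ b : Fin 2,
        Complex.normSq ((φ₀ (embIter (K - n) c.src) - ((Averaging.iter (fun i => blockAvg (P := F.P K) (j := i) (expMeanLogSU (n := Fin 2))) (K - n) W c : Matrix.specialUnitaryGroup (Fin 2) ℂ) : Matrix (Fin 2) (Fin 2) ℂ)
            * φ₀ (embIter (K - n) c.tgt) * star ((Averaging.iter (fun i => blockAvg (P := F.P K) (j := i) (expMeanLogSU (n := Fin 2))) (K - n) W c : Matrix.specialUnitaryGroup (Fin 2) ℂ) : Matrix (Fin 2) (Fin 2) ℂ)) a b))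
      ≤ ((F.L : ℝ) ^ (K - n)) * (ζ_X / θ) * (∑ p : Plaq (F.P K) 0, ‖((Complex.I • D ⟨p.src, p.μ⟩) + ((W ⟨p.src, p.μ⟩ : Matrix (Fin 2) (Fin 2) ℂ) * (Complex.I • D ⟨p.src.shift p.μ, p.ν⟩) * star (W ⟨p.src, p.μ⟩ : Matrix (Fin 2) (Fin 2) ℂ))
            - (((W ⟨p.src, p.μ⟩ * W ⟨p.src.shift p.μ, p.ν⟩ * (W ⟨p.src.shift p.ν, p.μ⟩)⁻¹ : Matrix.specialUnitaryGroup (Fin 2) ℂ) : Matrix (Fin 2) (Fin 2) ℂ) * (Complex.I • D ⟨p.src.shift p.ν, p.μ⟩) * star ((W ⟨p.src, p.μ⟩ * W ⟨p.src.shift p.μ, p.ν⟩ * (W ⟨p.src.shift p.ν, p.μ⟩)⁻¹ : Matrix.specialUnitaryGroup (Fin 2) ℂ) : Matrix (Fin 2) (Fin 2) ℂ))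
            - (((GaugeField.plaqHol W p : Matrix.specialUnitaryGroup (Fin 2) ℂ) : Matrix (Fin 2) (Fin 2) ℂ) * (Complex.I • D ⟨p.src, p.ν⟩) * star ((GaugeField.plaqHol W p : Matrix.specialUnitaryGroup (Fin 2) ℂ) : Matrix (Fin 2) (Fin 2) ℂ)))‖ ^ 2)
        + (θ + θ_q) * ((F.L : ℝ) ^ (K - n))⁻¹ * (∑ b : PBond (F.P K) 0, ‖D b‖ ^ 2)
        + (θ_X + 64 * ((4770 * (F.L : ℝ) ^ 3) ^ 2 * ((5 * (F.L : ℝ)) ^ 2 / 2) ^ 2 / 4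
              + (2 * (5 * (F.L : ℝ)) ^ 3 / ((F.L : ℝ) * ((F.L : ℝ) - 1) * ((F.L : ℝ) ^ 2 - 1)) + (2 * (5 * (F.L : ℝ)) + 2 * 3 + 1) ^ 2 / 2) ^ 2)
              + 768000000000 * (F.L : ℝ) ^ 9) * e * ((F.L : ℝ) ^ (K - n))⁻¹ * (∑ b : PBond (F.P K) 0, ‖D b‖ ^ 2)
        + (C_X + 8) * ((F.L : ℝ) ^ (K - n)) * (∑ b : PBond (F.P K) 0, ∑ ν : Fin (F.P K).d,
                ‖((W ⟨b.src, ν⟩ : Matrix.specialUnitaryGroup (Fin 2) ℂ) : Matrix (Fin 2) (Fin 2) ℂ) * B ⟨b.src.shift ν, b.dir⟩ * star ((W ⟨b.src, ν⟩ : Matrix.specialUnitaryGroup (Fin 2) ℂ) : Matrix (Fin 2) (Fin 2) ℂ) - B b‖ ^ 2)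
        + 19200 * (F.L : ℝ) ^ 4 * ((F.L : ℝ) ^ (K - n)) * (∑ x : Site (F.P K) 0, ∑ μ : Fin (F.P K).d, ∑ ν : Fin (F.P K).d,
                (if μ < ν then ∑ j : Fin 2, ∑ k : Fin 2, ‖(curl (torusT (F.P K) 0) (fun κ z => unitsField (toUField W) ⟨z, κ⟩) (fun κ z => B ⟨z, κ⟩) μ ν x) j k‖ ^ 2 else 0))
        + (η_X + η_q) * ((F.L : ℝ) ^ (K - n)) * (∑ x : Site (F.P K) 0, ∑ j : Fin 2, ∑ k : Fin 2,
              ‖(divB (torusT (F.P K) 0) (fun κ z => unitsField (toUField W) ⟨z, κ⟩) (fun κ z => Complex.I • D ⟨z, κ⟩) x) j k‖ ^ 2) := by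
  -- ===== member arithmetic letters =====
  have hd : (F.P K).d = 3 := T3Family.P_d F K
  have hLF : (F.P K).L = F.L := rfl
  have hL3 := three_le_L F
  have hLpos : (0 : ℝ) < (F.L : ℝ) := by linarith
  have hℓ : (0 : ℝ) < (F.L : ℝ) ^ (K - n) := pow_pos hLpos _
  have hk : K - n ≤ (F.P K).m + (F.P K).K := by show K - n ≤ F.m + K; omega
  have he1 : e ≤ 1 := by
    have h5 : (1 : ℝ) ≤ (F.L : ℝ) ^ 5 := one_le_pow₀ (by linarith)
    nlinarith
  have h2e1 : 2 * e ≤ 1 := by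
    have h5 : (3 : ℝ) ^ 5 ≤ (F.L : ℝ) ^ 5 := pow_le_pow_left₀ (by norm_num) hL3 5
    nlinarith
  -- ===== names for the energies =====
  set KD : ℝ := (∑ p : Plaq (F.P K) 0, ‖((Complex.I • D ⟨p.src, p.μ⟩) + ((W ⟨p.src, p.μ⟩ : Matrix (Fin 2) (Fin 2) ℂ) * (Complex.I • D ⟨p.src.shift p.μ, p.ν⟩) * star (W ⟨p.src, p.μ⟩ : Matrix (Fin 2) (Fin 2) ℂ))
            - (((W ⟨p.src, p.μ⟩ * W ⟨p.src.shift p.μ, p.ν⟩ * (W ⟨p.src.shift p.ν, p.μ⟩)⁻¹ : Matrix.specialUnitaryGroup (Fin 2) ℂ) : Matrix (Fin 2) (Fin 2) ℂ) * (Complex.I • D ⟨p.src.shift p.ν, p.μ⟩) * star ((W ⟨p.src, p.μ⟩ * W ⟨p.src.shift p.μ, p.ν⟩ * (W ⟨p.src.shift p.ν, p.μ⟩)⁻¹ : Matrix.specialUnitaryGroup (Fin 2) ℂ) : Matrix (Fin 2) (Fin 2) ℂ))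
            - (((GaugeField.plaqHol W p : Matrix.specialUnitaryGroup (Fin 2) ℂ) : Matrix (Fin 2) (Fin 2) ℂ) * (Complex.I • D ⟨p.src, p.ν⟩) * star ((GaugeField.plaqHol W p : Matrix.specialUnitaryGroup (Fin 2) ℂ) : Matrix (Fin 2) (Fin 2) ℂ)))‖ ^ 2) with hKD
  set MD : ℝ := (∑ b : PBond (F.P K) 0, ‖D b‖ ^ 2) with hMD
  set MB : ℝ := (∑ b : PBond (F.P K) 0, ‖B b‖ ^ 2) with hMB
  set GW : ℝ := (∑ b : PBond (F.P K) 0, ∑ ν : Fin (F.P K).d,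
                ‖((W ⟨b.src, ν⟩ : Matrix.specialUnitaryGroup (Fin 2) ℂ) : Matrix (Fin 2) (Fin 2) ℂ) * B ⟨b.src.shift ν, b.dir⟩ * star ((W ⟨b.src, ν⟩ : Matrix.specialUnitaryGroup (Fin 2) ℂ) : Matrix (Fin 2) (Fin 2) ℂ) - B b‖ ^ 2) with hGW
  set GLo : ℝ := (∑ b : PBond (F.P K) 0, ‖conjR (unitsField (toUField W) b) (B ⟨b.src.shift b.dir, b.dir⟩) - B b‖ ^ 2) with hGLo
  set CURL : ℝ := (∑ x : Site (F.P K) 0, ∑ μ : Fin (F.P K).d, ∑ ν : Fin (F.P K).d,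
                (if μ < ν then ∑ j : Fin 2, ∑ k : Fin 2, ‖(curl (torusT (F.P K) 0) (fun κ z => unitsField (toUField W) ⟨z, κ⟩) (fun κ z => B ⟨z, κ⟩) μ ν x) j k‖ ^ 2 else 0)) with hCURL
  set DIV : ℝ := (∑ x : Site (F.P K) 0, ∑ j : Fin 2, ∑ k : Fin 2,
              ‖(divB (torusT (F.P K) 0) (fun κ z => unitsField (toUField W) ⟨z, κ⟩) (fun κ z => Complex.I • D ⟨z, κ⟩) x) j k‖ ^ 2) with hDIV
  have hMD0 : 0 ≤ MD := Finset.sum_nonneg fun _ _ => sq_nonneg _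
  have hMB0 : 0 ≤ MB := Finset.sum_nonneg fun _ _ => sq_nonneg _
  have hGW0 : 0 ≤ GW := Finset.sum_nonneg fun _ _ => Finset.sum_nonneg fun _ _ => sq_nonneg _
  have hKD0 : 0 ≤ KD := Finset.sum_nonneg fun _ _ => sq_nonneg _
  have hGLW : GLo ≤ GW := sum_longGrad_le_covGrad W B
  have hBM : MB ≤ 2 * MD := by
    have h := sum_norm_sq_le_of_coclosed_split (N := 2) W D B φ₀ hsplit hBc
    simpa only [Nat.cast_ofNat] using h
  -- ===== (1) the families of `B` =====
  obtain ⟨G, hG0, hGs⟩ := exists_reduced_family (P := F.P K) (N := 2) W B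
  obtain ⟨S, hS0, hSs⟩ := exists_pureLine_family (P := F.P K) W B
  obtain ⟨Λ, hΛ0, hΛs⟩ := exists_coarseGauge_family (P := F.P K) (N := 2) W G
  -- ===== (2) R2′: the door's identity and the Λ-row =====
  obtain ⟨hR2, hΛb⟩ := covConstraintSplit_coclosed_T3 F n K W he heL hW Q hQ0 hQs D B φ₀ hsplit hBc G S Λ hΛ0 hG0 hS0 hΛs hGs hSs
  -- ===== (3) the reduced-vs-engine defect at `2e`, d = 3 reading =====
  obtain ⟨-, hε3, hε2, hε24, hεκ⟩ := smallness_T3 F K he heL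
  have hε' : 0 < 2 * e := by linarith only [he]
  have hU' : PlaqSmall (2 * e * ((((F.P K).L : ℝ) ^ (K - n))⁻¹) ^ 2) W := by
    refine plaqSmall_of_le_of_lt hW ?_
    rw [hLF, inv_pow]
    exact mul_lt_mul_of_pos_right (by linarith only [he]) (inv_pos.mpr (by positivity))
  have h8 := Prop7DefBookingEM.def_booking_eM_d3 hk W B G S hG0 hS0 hGs hSs hε' hε3 hε2 hε24 hU' hd hεκ h2e1 hMD0 hBM
  -- the constant of ✓RowE at `d = 3`, `L := F.L`
  have eC : ((318 * (F.P K).d * (((F.P K).d : ℝ) + 2) * ((F.P K).L : ℝ) ^ (F.P K).d) ^ 2 * (((((F.P K).d + 2) * (F.P K).L : ℕ) : ℝ) ^ 2 / 2) ^ 2 / 4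
              + (2 * ((((F.P K).d + 2) * (F.P K).L : ℕ) : ℝ) ^ 3 / (((F.P K).L : ℝ) * (((F.P K).L : ℝ) - 1) * (((F.P K).L : ℝ) ^ 2 - 1))
                  + ((2 * ((((F.P K).d + 2) * (F.P K).L : ℕ) : ℝ) + 2 * (F.P K).d + 1)) ^ 2 / 2) ^ 2)
      = ((4770 * (F.L : ℝ) ^ 3) ^ 2 * ((5 * (F.L : ℝ)) ^ 2 / 2) ^ 2 / 4
              + (2 * (5 * (F.L : ℝ)) ^ 3 / ((F.L : ℝ) * ((F.L : ℝ) - 1) * ((F.L : ℝ) ^ 2 - 1)) + (2 * (5 * (F.L : ℝ)) + 2 * 3 + 1) ^ 2 / 2) ^ 2) := by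
    rw [hd]; simp only [hLF]; push_cast; ring
  have hGX : 4 * (2 : ℝ) * ∑ c : PBond (F.P K) (K - n), ‖G (K - n) c - ((((F.P K).L : ℂ) ^ (K - n)) ^ (F.P K).d)⁻¹ • ((((holAt W (walk (embIter (K - n) c.src) (treeWord fun _ : Fin (F.P K).d => -((((F.P K).L ^ (K - n) - 1) / 2 : ℕ) : ℤ))) : Matrix.specialUnitaryGroup (Fin 2) ℂ) : Matrix (Fin 2) (Fin 2) ℂ))
          * (∑ r : Fin (F.P K).d → Fin ((F.P K).L ^ (K - n)), ∑ s ∈ Finset.range ((F.P K).L ^ (K - n)),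
              conjR (holT (unitsField (toUField W)) (Site.fibreSite 0 (K - n) c.src fun _ => ⟨0, pow_pos (F.P K).L_pos (K - n)⟩) (treeWord fun ν => ((r ν : ℕ) : ℤ))
                  * holT (unitsField (toUField W)) (Site.fibreSite 0 (K - n) c.src r) (List.replicate s (c.dir, true)))
                (B ⟨(fun z : Site (F.P K) 0 => z.shift c.dir)^[s] (Site.fibreSite 0 (K - n) c.src r), c.dir⟩))
          * star (((holAt W (walk (embIter (K - n) c.src) (treeWord fun _ : Fin (F.P K).d => -((((F.P K).L ^ (K - n) - 1) / 2 : ℕ) : ℤ))) : Matrix.specialUnitaryGroup (Fin 2) ℂ) : Matrix (Fin 2) (Fin 2) ℂ)))‖ ^ 2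
      ≤ 64 * ((4770 * (F.L : ℝ) ^ 3) ^ 2 * ((5 * (F.L : ℝ)) ^ 2 / 2) ^ 2 / 4
              + (2 * (5 * (F.L : ℝ)) ^ 3 / ((F.L : ℝ) * ((F.L : ℝ) - 1) * ((F.L : ℝ) ^ 2 - 1)) + (2 * (5 * (F.L : ℝ)) + 2 * 3 + 1) ^ 2 / 2) ^ 2) * e * ((F.L : ℝ) ^ (K - n))⁻¹ * MD := by
    have h := h8
    rw [eC] at h
    simp only [hLF, Nat.cast_ofNat] at h
    refine h.trans (le_of_eq ?_)
    ring
  -- the seam `LINE_ℝ = X_ℂ`, and the door's `hL` in final currency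
  have hscal : ((((((F.P K).L : ℝ) ^ (K - n)) ^ (F.P K).d)⁻¹ : ℝ) : ℂ) = ((((F.P K).L : ℂ) ^ (K - n)) ^ (F.P K).d)⁻¹ := by push_cast; ring
  have hL : ∑ c : PBond (F.P K) (K - n), ‖G (K - n) c - ((((F.P K).L : ℝ) ^ (K - n)) ^ (F.P K).d)⁻¹ • ((((holAt W (walk (embIter (K - n) c.src) (treeWord fun _ : Fin (F.P K).d => -((((F.P K).L ^ (K - n) - 1) / 2 : ℕ) : ℤ))) : Matrix.specialUnitaryGroup (Fin 2) ℂ) : Matrix (Fin 2) (Fin 2) ℂ))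
          * (∑ r : Fin (F.P K).d → Fin ((F.P K).L ^ (K - n)), ∑ s ∈ Finset.range ((F.P K).L ^ (K - n)),
              conjR (holT (unitsField (toUField W)) (Site.fibreSite 0 (K - n) c.src fun _ => ⟨0, pow_pos (F.P K).L_pos (K - n)⟩) (treeWord fun ν => ((r ν : ℕ) : ℤ))
                  * holT (unitsField (toUField W)) (Site.fibreSite 0 (K - n) c.src r) (List.replicate s (c.dir, true)))
                (B ⟨(fun z : Site (F.P K) 0 => z.shift c.dir)^[s] (Site.fibreSite 0 (K - n) c.src r), c.dir⟩))
          * star (((holAt W (walk (embIter (K - n) c.src) (treeWord fun _ : Fin (F.P K).d => -((((F.P K).L ^ (K - n) - 1) / 2 : ℕ) : ℤ))) : Matrix.specialUnitaryGroup (Fin 2) ℂ) : Matrix (Fin 2) (Fin 2) ℂ)))‖ ^ 2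
      ≤ 8 * ((4770 * (F.L : ℝ) ^ 3) ^ 2 * ((5 * (F.L : ℝ)) ^ 2 / 2) ^ 2 / 4
              + (2 * (5 * (F.L : ℝ)) ^ 3 / ((F.L : ℝ) * ((F.L : ℝ) - 1) * ((F.L : ℝ) ^ 2 - 1)) + (2 * (5 * (F.L : ℝ)) + 2 * 3 + 1) ^ 2 / 2) ^ 2) * e * ((F.L : ℝ) ^ (K - n))⁻¹ * MD := by
    have hconv : ∑ c : PBond (F.P K) (K - n), ‖G (K - n) c - ((((F.P K).L : ℝ) ^ (K - n)) ^ (F.P K).d)⁻¹ • ((((holAt W (walk (embIter (K - n) c.src) (treeWord fun _ : Fin (F.P K).d => -((((F.P K).L ^ (K - n) - 1) / 2 : ℕ) : ℤ))) : Matrix.specialUnitaryGroup (Fin 2) ℂ) : Matrix (Fin 2) (Fin 2) ℂ))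
          * (∑ r : Fin (F.P K).d → Fin ((F.P K).L ^ (K - n)), ∑ s ∈ Finset.range ((F.P K).L ^ (K - n)),
              conjR (holT (unitsField (toUField W)) (Site.fibreSite 0 (K - n) c.src fun _ => ⟨0, pow_pos (F.P K).L_pos (K - n)⟩) (treeWord fun ν => ((r ν : ℕ) : ℤ))
                  * holT (unitsField (toUField W)) (Site.fibreSite 0 (K - n) c.src r) (List.replicate s (c.dir, true)))
                (B ⟨(fun z : Site (F.P K) 0 => z.shift c.dir)^[s] (Site.fibreSite 0 (K - n) c.src r), c.dir⟩))
          * star (((holAt W (walk (embIter (K - n) c.src) (treeWord fun _ : Fin (F.P K).d => -((((F.P K).L ^ (K - n) - 1) / 2 : ℕ) : ℤ))) : Matrix.specialUnitaryGroup (Fin 2) ℂ) : Matrix (Fin 2) (Fin 2) ℂ)))‖ ^ 2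
        = ∑ c : PBond (F.P K) (K - n), ‖G (K - n) c - ((((F.P K).L : ℂ) ^ (K - n)) ^ (F.P K).d)⁻¹ • ((((holAt W (walk (embIter (K - n) c.src) (treeWord fun _ : Fin (F.P K).d => -((((F.P K).L ^ (K - n) - 1) / 2 : ℕ) : ℤ))) : Matrix.specialUnitaryGroup (Fin 2) ℂ) : Matrix (Fin 2) (Fin 2) ℂ))
          * (∑ r : Fin (F.P K).d → Fin ((F.P K).L ^ (K - n)), ∑ s ∈ Finset.range ((F.P K).L ^ (K - n)),
              conjR (holT (unitsField (toUField W)) (Site.fibreSite 0 (K - n) c.src fun _ => ⟨0, pow_pos (F.P K).L_pos (K - n)⟩) (treeWord fun ν => ((r ν : ℕ) : ℤ))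
                  * holT (unitsField (toUField W)) (Site.fibreSite 0 (K - n) c.src r) (List.replicate s (c.dir, true)))
                (B ⟨(fun z : Site (F.P K) 0 => z.shift c.dir)^[s] (Site.fibreSite 0 (K - n) c.src r), c.dir⟩))
          * star (((holAt W (walk (embIter (K - n) c.src) (treeWord fun _ : Fin (F.P K).d => -((((F.P K).L ^ (K - n) - 1) / 2 : ℕ) : ℤ))) : Matrix.specialUnitaryGroup (Fin 2) ℂ) : Matrix (Fin 2) (Fin 2) ℂ)))‖ ^ 2 :=
      Finset.sum_congr rfl fun c _ => by rw [real_smul_eq_coe_smul, hscal]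
    rw [hconv]
    linarith [hGX]
  -- ===== (4) the line-vs-face step (E) at the member letters, in final currency =====
  have h0k : (F.P K).sitesPerDir 0 = (F.P K).L ^ (K - n) * (F.P K).sitesPerDir (K - n) := Prop7FlatCoercivity.sitesPerDir_zero_eq_pow_mul hk
  have hV : ∀ b : PBond (F.P K) 0, unitsField (toUField W) b ∈ U1 (Matrix (Fin 2) (Fin 2) ℂ) := fun b => B11Thm1LevelZero.unitsField_toUField_mem_U1 W b
  have hgL : ∀ c : PBond (F.P K) (K - n), ‖(((holAt W (walk (embIter (K - n) c.src) (treeWord fun _ : Fin (F.P K).d => -((((F.P K).L ^ (K - n) - 1) / 2 : ℕ) : ℤ))) : Matrix.specialUnitaryGroup (Fin 2) ℂ) : Matrix (Fin 2) (Fin 2) ℂ))‖ ≤ 1 := fun c =>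
    le_of_eq (CStarRing.norm_of_mem_unitary (Matrix.specialUnitaryGroup_le_unitaryGroup (holAt W (walk (embIter (K - n) c.src)
      (treeWord fun _ : Fin (F.P K).d => -((((F.P K).L ^ (K - n) - 1) / 2 : ℕ) : ℤ)))).2))
  have hgR : ∀ c : PBond (F.P K) (K - n), ‖star (((holAt W (walk (embIter (K - n) c.src) (treeWord fun _ : Fin (F.P K).d => -((((F.P K).L ^ (K - n) - 1) / 2 : ℕ) : ℤ))) : Matrix.specialUnitaryGroup (Fin 2) ℂ) : Matrix (Fin 2) (Fin 2) ℂ))‖ ≤ 1 := fun c => by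
    rw [norm_star]; exact hgL c
  have hw : ∀ (c : PBond (F.P K) (K - n)) (r : Fin (F.P K).d → Fin ((F.P K).L ^ (K - n))),
      holT (unitsField (toUField W)) (Site.fibreSite 0 (K - n) c.src fun _ => ⟨0, pow_pos (F.P K).L_pos (K - n)⟩) (treeWord fun ν => ((r ν : ℕ) : ℤ)) ∈ U1 (Matrix (Fin 2) (Fin 2) ℂ) :=
    fun c r => holT_unitsField_mem_U1 W _ _
  have ht₀ : ∀ (c : PBond (F.P K) (K - n)) (r : Fin (F.P K).d → Fin ((F.P K).L ^ (K - n))), (F.P K).L ^ (K - n) - 1 - (r c.dir : ℕ) < (F.P K).L ^ (K - n) := by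
    intro c r
    have := pow_pos (F.P K).L_pos (K - n)
    omega
  have hE0 := sum_normSq_lineFun_sub_faceFun_le (N := 2) h0k hV (fun c => (((holAt W (walk (embIter (K - n) c.src) (treeWord fun _ : Fin (F.P K).d => -((((F.P K).L ^ (K - n) - 1) / 2 : ℕ) : ℤ))) : Matrix.specialUnitaryGroup (Fin 2) ℂ) : Matrix (Fin 2) (Fin 2) ℂ))) (fun c => star (((holAt W (walk (embIter (K - n) c.src) (treeWord fun _ : Fin (F.P K).d => -((((F.P K).L ^ (K - n) - 1) / 2 : ℕ) : ℤ))) : Matrix.specialUnitaryGroup (Fin 2) ℂ) : Matrix (Fin 2) (Fin 2) ℂ))) hgL hgR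
    (fun c r => holT (unitsField (toUField W)) (Site.fibreSite 0 (K - n) c.src fun _ => ⟨0, pow_pos (F.P K).L_pos (K - n)⟩) (treeWord fun ν => ((r ν : ℕ) : ℤ)))
    hw (fun c r => (F.P K).L ^ (K - n) - 1 - (r c.dir : ℕ)) ht₀ B
  have hEscal : (((F.P K).L : ℝ) ^ (K - n)) ^ 4 * ((((F.P K).L : ℝ) ^ (K - n)) ^ (F.P K).d)⁻¹ = (F.L : ℝ) ^ (K - n) := by
    rw [hd]; simp only [hLF]; field_simp
  have hE : ∑ c : PBond (F.P K) (K - n), ‖((((F.P K).L : ℝ) ^ (K - n)) ^ (F.P K).d)⁻¹ • ((((holAt W (walk (embIter (K - n) c.src) (treeWord fun _ : Fin (F.P K).d => -((((F.P K).L ^ (K - n) - 1) / 2 : ℕ) : ℤ))) : Matrix.specialUnitaryGroup (Fin 2) ℂ) : Matrix (Fin 2) (Fin 2) ℂ))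
          * (∑ r : Fin (F.P K).d → Fin ((F.P K).L ^ (K - n)), ∑ s ∈ Finset.range ((F.P K).L ^ (K - n)),
              conjR (holT (unitsField (toUField W)) (Site.fibreSite 0 (K - n) c.src fun _ => ⟨0, pow_pos (F.P K).L_pos (K - n)⟩) (treeWord fun ν => ((r ν : ℕ) : ℤ))
                  * holT (unitsField (toUField W)) (Site.fibreSite 0 (K - n) c.src r) (List.replicate s (c.dir, true)))
                (B ⟨(fun z : Site (F.P K) 0 => z.shift c.dir)^[s] (Site.fibreSite 0 (K - n) c.src r), c.dir⟩))
          * star (((holAt W (walk (embIter (K - n) c.src) (treeWord fun _ : Fin (F.P K).d => -((((F.P K).L ^ (K - n) - 1) / 2 : ℕ) : ℤ))) : Matrix.specialUnitaryGroup (Fin 2) ℂ) : Matrix (Fin 2) (Fin 2) ℂ)))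
        - ((((F.P K).L : ℝ) ^ (K - n)) ^ (F.P K).d)⁻¹ •
              ((((holAt W (walk (embIter (K - n) c.src) (treeWord fun _ : Fin (F.P K).d => -((((F.P K).L ^ (K - n) - 1) / 2 : ℕ) : ℤ))) : Matrix.specialUnitaryGroup (Fin 2) ℂ) : Matrix (Fin 2) (Fin 2) ℂ))
                * ((((F.P K).L : ℝ) ^ (K - n)) • ∑ r : Fin (F.P K).d → Fin ((F.P K).L ^ (K - n)),
                    conjR (holT (unitsField (toUField W)) (Site.fibreSite 0 (K - n) c.src fun _ => ⟨0, pow_pos (F.P K).L_pos (K - n)⟩) (treeWord fun ν => ((r ν : ℕ) : ℤ))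
                  * holT (unitsField (toUField W)) (Site.fibreSite 0 (K - n) c.src r) (List.replicate ((F.P K).L ^ (K - n) - 1 - (r c.dir : ℕ)) (c.dir, true)))
                (B ⟨(fun z : Site (F.P K) 0 => z.shift c.dir)^[((F.P K).L ^ (K - n) - 1 - (r c.dir : ℕ))] (Site.fibreSite 0 (K - n) c.src r), c.dir⟩))
                * star (((holAt W (walk (embIter (K - n) c.src) (treeWord fun _ : Fin (F.P K).d => -((((F.P K).L ^ (K - n) - 1) / 2 : ℕ) : ℤ))) : Matrix.specialUnitaryGroup (Fin 2) ℂ) : Matrix (Fin 2) (Fin 2) ℂ)))‖ ^ 2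
      ≤ (F.L : ℝ) ^ (K - n) * GW := by
    refine hE0.trans ?_
    rw [hEscal]
    exact mul_le_mul_of_nonneg_left hGLW hℓ.le
  -- ===== (5)+(6) px17's R3′ door with hX in its letters (CF := ζ_X, K′ := K, Ce := θ_X, CG := 0, JVH := C_X·ℓ·G_W) =====
  have hdoor := sum_normSq_centreDiff_le_of_rows (N := 2)
    (Averaging.iter (fun i => blockAvg (P := F.P K) (j := i) (expMeanLogSU (n := Fin 2))) (K - n) W) φ₀ (Λ (K - n)) (G (K - n)) (Q (K - n) D)
    (fun c => ((((F.P K).L : ℝ) ^ (K - n)) ^ (F.P K).d)⁻¹ • ((((holAt W (walk (embIter (K - n) c.src) (treeWord fun _ : Fin (F.P K).d => -((((F.P K).L ^ (K - n) - 1) / 2 : ℕ) : ℤ))) : Matrix.specialUnitaryGroup (Fin 2) ℂ) : Matrix (Fin 2) (Fin 2) ℂ))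
          * (∑ r : Fin (F.P K).d → Fin ((F.P K).L ^ (K - n)), ∑ s ∈ Finset.range ((F.P K).L ^ (K - n)),
              conjR (holT (unitsField (toUField W)) (Site.fibreSite 0 (K - n) c.src fun _ => ⟨0, pow_pos (F.P K).L_pos (K - n)⟩) (treeWord fun ν => ((r ν : ℕ) : ℤ))
                  * holT (unitsField (toUField W)) (Site.fibreSite 0 (K - n) c.src r) (List.replicate s (c.dir, true)))
                (B ⟨(fun z : Site (F.P K) 0 => z.shift c.dir)^[s] (Site.fibreSite 0 (K - n) c.src r), c.dir⟩))
          * star (((holAt W (walk (embIter (K - n) c.src) (treeWord fun _ : Fin (F.P K).d => -((((F.P K).L ^ (K - n) - 1) / 2 : ℕ) : ℤ))) : Matrix.specialUnitaryGroup (Fin 2) ℂ) : Matrix (Fin 2) (Fin 2) ℂ))))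
    (fun c => ((((F.P K).L : ℝ) ^ (K - n)) ^ (F.P K).d)⁻¹ •
              ((((holAt W (walk (embIter (K - n) c.src) (treeWord fun _ : Fin (F.P K).d => -((((F.P K).L ^ (K - n) - 1) / 2 : ℕ) : ℤ))) : Matrix.specialUnitaryGroup (Fin 2) ℂ) : Matrix (Fin 2) (Fin 2) ℂ))
                * ((((F.P K).L : ℝ) ^ (K - n)) • ∑ r : Fin (F.P K).d → Fin ((F.P K).L ^ (K - n)),
                    conjR (holT (unitsField (toUField W)) (Site.fibreSite 0 (K - n) c.src fun _ => ⟨0, pow_pos (F.P K).L_pos (K - n)⟩) (treeWord fun ν => ((r ν : ℕ) : ℤ))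
                  * holT (unitsField (toUField W)) (Site.fibreSite 0 (K - n) c.src r) (List.replicate ((F.P K).L ^ (K - n) - 1 - (r c.dir : ℕ)) (c.dir, true)))
                (B ⟨(fun z : Site (F.P K) 0 => z.shift c.dir)^[((F.P K).L ^ (K - n) - 1 - (r c.dir : ℕ))] (Site.fibreSite 0 (K - n) c.src r), c.dir⟩))
                * star (((holAt W (walk (embIter (K - n) c.src) (treeWord fun _ : Fin (F.P K).d => -((((F.P K).L ^ (K - n) - 1) / 2 : ℕ) : ℤ))) : Matrix.specialUnitaryGroup (Fin 2) ℂ) : Matrix (Fin 2) (Fin 2) ℂ))))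
    (CF := ζ_X) (θ := θ) (ℓ := (F.L : ℝ) ^ (K - n)) (K' := KD) (M := MD) (Ce := θ_X) (e := e) (CG := 0) (JVH := C_X * (F.L : ℝ) ^ (K - n) * GW + η_X * (F.L : ℝ) ^ (K - n) * DIV)
    hR2 hL hE (by
      have e1 : ζ_X / θ * (F.L : ℝ) ^ (K - n) * KD = (F.L : ℝ) ^ (K - n) * (ζ_X / θ) * KD := by ring
      linarith [hXb, e1])
  -- ===== (7) bookkeeping =====
  have h96 : 16 * ((F.P K).d : ℝ) * (2 : ℝ) * ∑ y : Site (F.P K) (K - n), ‖Λ (K - n) y‖ ^ 2 = 96 * ∑ y : Site (F.P K) (K - n), ‖Λ (K - n) y‖ ^ 2 := by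
    rw [hd]; norm_num
  have hΛv : 96 * ∑ y : Site (F.P K) (K - n), ‖Λ (K - n) y‖ ^ 2
      ≤ 19200 * (F.L : ℝ) ^ 4 * (F.L : ℝ) ^ (K - n) * CURL + 768000000000 * (F.L : ℝ) ^ 9 * e * ((F.L : ℝ) ^ (K - n))⁻¹ * MD := by
    have h1 := mul_le_mul_of_nonneg_left hΛb (by norm_num : (0 : ℝ) ≤ 96)
    have e2 : 96 * ((F.L : ℝ) ^ (K - n) * (100 * (2 : ℕ) * (F.L : ℝ) ^ 4 * CURL + 10 ^ 9 * (2 : ℕ) ^ 2 * (F.L : ℝ) ^ 9 * e * (((F.L : ℝ) ^ (K - n)) ^ 2)⁻¹ * MB))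
        = 19200 * (F.L : ℝ) ^ 4 * (F.L : ℝ) ^ (K - n) * CURL + 384000000000 * (F.L : ℝ) ^ 9 * e * ((F.L : ℝ) ^ (K - n))⁻¹ * MB := by
      push_cast
      field_simp
      ring
    rw [e2] at h1
    have h3 : 384000000000 * (F.L : ℝ) ^ 9 * e * ((F.L : ℝ) ^ (K - n))⁻¹ * MB ≤ 768000000000 * (F.L : ℝ) ^ 9 * e * ((F.L : ℝ) ^ (K - n))⁻¹ * MD := by
      have h0 : 0 ≤ 384000000000 * (F.L : ℝ) ^ 9 * e * ((F.L : ℝ) ^ (K - n))⁻¹ := by positivity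
      have := mul_le_mul_of_nonneg_left hBM h0
      linarith
    linarith
  simp only [Nat.cast_ofNat] at hdoor
  rw [h96] at hdoor
  -- freeze the `L`-polynomial constant as one atom for the linear bookkeeping
  set CC : ℝ := ((4770 * (F.L : ℝ) ^ 3) ^ 2 * ((5 * (F.L : ℝ)) ^ 2 / 2) ^ 2 / 4
              + (2 * (5 * (F.L : ℝ)) ^ 3 / ((F.L : ℝ) * ((F.L : ℝ) - 1) * ((F.L : ℝ) ^ 2 - 1)) + (2 * (5 * (F.L : ℝ)) + 2 * 3 + 1) ^ 2 / 2) ^ 2) with hCCdef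
  set ℓ : ℝ := (F.L : ℝ) ^ (K - n) with hℓdef
  set QD : ℝ := ∑ c : PBond (F.P K) (K - n), ‖Q (K - n) D c‖ ^ 2 with hQD
  set LΛ : ℝ := ∑ y : Site (F.P K) (K - n), ‖Λ (K - n) y‖ ^ 2 with hLΛ
  linarith only [hdoor, hΛv, hq]

end Summit.QuantumFields.YangMills.Theorems.Prop7RowPOfFaceFluxRows

end
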